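import Mathlib
import Literature.Analysis.FluidPDE.VectorCalculus

/-!
# Conformal-symplectic annihilators of the linearised map: abstract lemma, the STRAIGHT-FILAMENT MODEL identity (weight `3/2`),
# and the scaling-mode pairing with the rate column
# (crux `Clause13RNearStraightL`, stmt-NavierStokesRegularity-23612; line `rate_bordered_split`, STUB R `stub_rateRow13RFlat`)

Route `FilamentSkeletonRss`, Variant A1R.  By the landed structure files of hands fsrs-8-g0/g1 (`…Clause13RHomogeneity`,
`…Clause13RTransversality`), the registered STUB R is EXACT TRANSVERSALITY of the rate column `R_j = P_n(e₃ × X_j)` to the range of the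
linearised map `DT` on clamped test fields, with ZERO `Y`-information; hence (repair census of fsrs-8-g0, option (ii)) a pairing proof of R
needs an EXACT annihilator `ψ` of `range DT` (`∫⟪ψ, DT·Y⟫ = 0` for every clamped `Y`) whose pairing with `R_j` is `≳ √Γ·‖ψ‖_{L¹}`.
THIS FILE (v3 — v1 = p824936, v2 = p825045, same hand; v2 appends §3 and CORRECTS the heuristic paragraph of the v1 header, see «Correction» below):

§1 (abstract, any real vector space) `annihilates_of_conformal_eigen`: if a bilinear form `ω` and a linear map `D` satisfy the
CONFORMAL-SYMPLECTIC identity `ω(D Y₁, Y₂) + ω(Y₁, D Y₂) = c·ω(Y₁, Y₂)` and `D K = c•K`, then `ω(K, D Y) = 0` for all `Y`; and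
`rate_bound_of_conformal_eigen` / `abs_rate_le_of_conformal_eigen`: then `|dα|·|ω(K, R)| = |ω(K, D Y − dα•R)|` — the bordered rate bound from
such a `K`, with no information on `Y`.  So exact annihilators of `range D` through `ω` are exactly `ω(K, ·)` for `K ∈ ker(D − c)`.

§3 (appended in v2; the MODEL identity that fixes `c`) For the straight-filament model operator on normal fields (unit tangent `t`, `J = t×`)
  `L Y = A•J Y″ + μ•Y − β•J Y − w•Y′`
(`A` = local-induction coefficient, `μ` = isotropic normal rate, `β` = projected rotation rate `α⟪t,e₃⟫`, `w` = slip), the Marsden–Weinstein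
density `⟪t, Y₁ × Y₂⟫ = ⟪J Y₁, Y₂⟫` satisfies, POINTWISE and exactly (`model_conformal_algebra[_normal]`, `flux_hasDerivAt`,
`model_conformal_pointwise`):
  `⟪J(L Y₁), Y₂⟫ + ⟪J Y₁, L Y₂⟫ = (2μ + w′)·⟪J Y₁, Y₂⟫ + d/dτ[ A(⟪Y₁, Y₂′⟫ − ⟪Y₁′, Y₂⟫) − w⟪J Y₁, Y₂⟫ ]`
— the dispersive part `A•J∂²` and the rotation `−β•J` are `ω`-skew, the isotropic rate contributes `2μ`, the transport contributes `w′` plus a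
flux; and INTEGRATED against a clamped `Y₂` (`Y₂ = Y₂′ = 0` at both ends) the flux drops (`model_conformal_integral`):
  `∫_a^b ⟪J(L Y₁), Y₂⟫ + ⟪J Y₁, L Y₂⟫ = ∫_a^b (2μ + w′)⟪J Y₁, Y₂⟫`, for EVERY (unclamped) normal `Y₁`.
§4 (appended in v3) `model_annihilator_of_eigen`: with LINEAR slip (`w′ ≡ κ`) every normal `K` solving `L K = (2μ + κ)•K` (no boundary
condition) gives the exact annihilator `t × K` of the clamped range: `∫_a^b ⟪t × K, L Y⟫ = 0` — §1 realised in the model.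
Bookkeeping for clause 13 (heuristic, not typed here): the normal block of `∇v = ∇u + ½I − α[e₃×]` at the filament has isotropic part
`μ = ½ + ½·tr_N S` with `tr_N S = −⟪t, S t⟫` (partner strain, divergence-free and curl-free at filament `j`), its traceless part is `ω`-neutral,
and `w′ = ⟪t, S t⟫ + ½` (clause 7 + tangency); hence the conformal weight is the CONSTANT `c = 2μ + w′ = 3/2` — the stretching cancels
between the strain block and the transport term.

§2 (vector algebra in `ℝ³`, v1) the `L²` representative of `ω(K, ·)` is `ψ = t × K` (`inner_cross_cyclic`), and for the SCALING / time-shift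
mode `K₁ = P_n(½x − α e₃×x)` the pairing density against the rate column is, exactly (`scalingMode_pairing`, unit `t`):
  `⟪t × (½x − α e₃×x), e₃×x − ⟪e₃×x, t⟫t⟫ = ½(⟪t, e₃⟫‖x‖² − ⟪t, x⟫⟪x, e₃⟫)`,
affine in `τ` along an affine model `x = p + τ•d` (`scalingMode_pairing_affine[_density]`: the `τ²` terms cancel), zero along a line through
the foot `p = 0` (`scalingMode_pairing_onAxisLine`), `τ`-independent part `≤ 2‖p‖²` (`scalingMode_constTerm_abs_le`).

«CORRECTION of the v1 header (p824936)».  The v1 header's heuristic paragraph asserted the weight `c = 1` and hence that the scaling mode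
(`DT·K₁ = 1·K₁`, time-shift symmetry) is an exact annihilator direction, reading §2 as «the symmetry annihilator certifies the rate row only with a
`√(log Γ)` loss — the mechanism behind the kit-S0 drift».  §3 shows the model weight is `c = 3/2`, NOT `1`: the symmetry eigenvalues of `DT`
(rotation `0`, translations `½` — exact: `…Clause13TranslationCovariance` —, scaling `1`) all differ from `3/2`, so NO exact annihilator of
`range DT` is symmetry-generated; §2 remains correct algebra about the scaling mode's pairing but does NOT describe an annihilator, and the
«`√(log Γ)`-loss mechanism» reading is WITHDRAWN.  What stands (planner-facing, heuristic): exact annihilators are `J·ker(DT − 3/2)` restricted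
to the ball — a 4-real-dimensional family per filament of NEAR-AFFINE fields `K = a + τb + O(ε) + O(1/log Γ)` (`ε = ℓ²/A ≍ R_b²`), all of which
must be CONSTRUCTED (local solutions of `(DT − 3/2)K = 0`; needs the clause dictionary (c1) and curvature slaving on the ball); the tilt
direction `b ∥ J(e₃ × d)` pairs with the rate column at `(2/3)ℓ³‖e₃ × d‖²` against `L¹`-mass `≍ ℓ²`, i.e. STUB R is heuristically TRUE with
margin `≍ R_b√(log Γ)·θ₀(2−θ₀)` and the registered split R | J needs no log-weighted retype on this account.

Hand `leafhand-ns-filamentskeletonrs-8-g1` (LAND-ONLY); `--supports stmt-NavierStokesRegularity-23612` helper.  HONEST FRAMING: linear/vector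
algebra and one-variable calculus about a MODEL of a HYPOTHETICAL filament skeleton's linearised operator on the NEGATIVE side of a MODEL
blow-up route; STUB R is NOT proved here and nothing in this file bears on Navier–Stokes regularity or blow-up.
-/

noncomputable section

open scoped InnerProductSpace
open Literature.Analysis.FluidPDE

namespace Summit.NavierStokesRegularity.NavierStokesRegularity.Theorems.Clause13RScalingAnnihilator
set_option linter.dupNamespace false

/-! ## §1 Conformal-symplectic annihilators (abstract) -/

variable {V : Type*} [AddCommGroup V] [Module ℝ V]

/-- **Conformal-symplectic annihilator lemma.**  If `ω(D Y₁, Y₂) + ω(Y₁, D Y₂) = c·ω(Y₁, Y₂)` for all `Y₁, Y₂` and `D K = c•K`, then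
`ω(K, D Y) = 0` for every `Y`: the `c`-eigenvectors of `D` are exact annihilators of `range D` through `ω`. [folklore] -/
theorem annihilates_of_conformal_eigen (ω : V →ₗ[ℝ] V →ₗ[ℝ] ℝ) (D : V →ₗ[ℝ] V) (c : ℝ)
    (hconf : ∀ Y₁ Y₂, ω (D Y₁) Y₂ + ω Y₁ (D Y₂) = c * ω Y₁ Y₂) {K : V} (hK : D K = c • K) (Y : V) :
    ω K (D Y) = 0 := by
  have h := hconf K Y
  rw [hK, map_smul, LinearMap.smul_apply, smul_eq_mul] at h
  linarith

/-- **Bordered rate identity from a conformal eigenvector**: with `F = D Y − dα•R` (the bordered defect),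
`ω(K, F) = −dα·ω(K, R)`, hence `|dα|·|ω(K, R)| = |ω(K, F)|` — any bound on the pairing of `K` with the defect bounds the rate increment,
with NO information on `Y`. [folklore] -/
theorem rate_bound_of_conformal_eigen (ω : V →ₗ[ℝ] V →ₗ[ℝ] ℝ) (D : V →ₗ[ℝ] V) (c : ℝ)
    (hconf : ∀ Y₁ Y₂, ω (D Y₁) Y₂ + ω Y₁ (D Y₂) = c * ω Y₁ Y₂) {K : V} (hK : D K = c • K) (Y R : V) (dα : ℝ) :
    |dα| * |ω K R| = |ω K (D Y - dα • R)| := by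
  rw [map_sub, map_smul, annihilates_of_conformal_eigen ω D c hconf hK Y, smul_eq_mul, zero_sub, abs_neg, abs_mul]

/-- Hence a pairing floor `m ≤ |ω(K, R)|` and a defect bound `|ω(K, D Y − dα•R)| ≤ B` give `|dα|·m ≤ B`. [folklore] -/
theorem abs_rate_le_of_conformal_eigen (ω : V →ₗ[ℝ] V →ₗ[ℝ] ℝ) (D : V →ₗ[ℝ] V) (c : ℝ)
    (hconf : ∀ Y₁ Y₂, ω (D Y₁) Y₂ + ω Y₁ (D Y₂) = c * ω Y₁ Y₂) {K : V} (hK : D K = c • K) (Y R : V) {dα m B : ℝ}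
    (hm : m ≤ |ω K R|) (hB : |ω K (D Y - dα • R)| ≤ B) : |dα| * m ≤ B :=
  le_trans (mul_le_mul_of_nonneg_left hm (abs_nonneg _))
    (le_trans (le_of_eq (rate_bound_of_conformal_eigen ω D c hconf hK Y R dα)) hB)

/-! ## §2 The scaling-mode pairing with the rate column (vector algebra in `ℝ³`) -/

/-- Cyclic triple product: `⟪t, K × Z⟫ = ⟪t × K, Z⟫` — the `L²` representative of the Marsden–Weinstein density `⟪t, K × ·⟫` is `t × K`.
[folklore] -/
theorem inner_cross_cyclic (t K Z : EuclideanSpace ℝ (Fin 3)) : ⟪t, cross K Z⟫_ℝ = ⟪cross t K, Z⟫_ℝ := by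
  simp only [cross, cross_apply, PiLp.inner_apply, RCLike.inner_apply, conj_trivial, Fin.sum_univ_three,
    Matrix.cons_val_zero, Matrix.cons_val_one, Matrix.cons_val_two, Matrix.head_cons, Matrix.tail_cons]
  ring

/-- The projector part drops against `t × K`: `⟪t × K, ⟪w, t⟫•t⟫ = 0`. [folklore] -/
theorem inner_cross_smul_tangent (t K w : EuclideanSpace ℝ (Fin 3)) : ⟪cross t K, ⟪w, t⟫_ℝ • t⟫_ℝ = 0 := by
  rw [real_inner_smul_right]
  have h : ⟪cross t K, t⟫_ℝ = 0 := by
    simp only [cross, cross_apply, PiLp.inner_apply, RCLike.inner_apply, conj_trivial, Fin.sum_univ_three,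
      Matrix.cons_val_zero, Matrix.cons_val_one, Matrix.cons_val_two, Matrix.head_cons, Matrix.tail_cons]
    ring
  rw [h, mul_zero]

/-- **The scaling-mode pairing density, exactly**: for a unit tangent `t`,
`⟪t × (½x − α e₃×x), e₃×x − ⟪e₃×x, t⟫t⟫ = ½(⟪t,e₃⟫‖x‖² − ⟪t,x⟫⟪x,e₃⟫)` — the rotation-rate term drops and the rest is Binet–Cauchy.
[folklore] -/
theorem scalingMode_pairing (t x : EuclideanSpace ℝ (Fin 3)) (α : ℝ) :
    ⟪cross t ((1 / 2 : ℝ) • x - α • cross (EuclideanSpace.single 2 1) x),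
        cross (EuclideanSpace.single 2 1) x - ⟪cross (EuclideanSpace.single 2 1) x, t⟫_ℝ • t⟫_ℝ
      = (1 / 2 : ℝ) * (⟪t, EuclideanSpace.single 2 1⟫_ℝ * ‖x‖ ^ 2 - ⟪t, x⟫_ℝ * ⟪x, EuclideanSpace.single 2 1⟫_ℝ) := by
  rw [inner_sub_right, inner_cross_smul_tangent, sub_zero, ← real_inner_self_eq_norm_sq]
  simp only [cross, cross_apply, PiLp.inner_apply, RCLike.inner_apply, conj_trivial, Fin.sum_univ_three,
    Matrix.cons_val_zero, Matrix.cons_val_one, Matrix.cons_val_two, Matrix.head_cons, Matrix.tail_cons,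
    WithLp.ofLp_sub, WithLp.ofLp_smul, Pi.sub_apply, Pi.smul_apply, smul_eq_mul, PiLp.single_apply]
  simp only [Fin.isValue, Fin.reduceEq, ↓reduceIte, mul_zero, zero_mul, sub_zero, zero_sub, add_zero, zero_add]
  ring

/-- **Affine model: the `τ²` terms cancel.**  With `x = p + τ•d`, `t = d`, `‖d‖ = 1`:
`⟪d,e₃⟫‖x‖² − ⟪d,x⟫⟪x,e₃⟫ = (⟪d,e₃⟫‖p‖² − ⟪d,p⟫⟪p,e₃⟫) + τ(⟪d,e₃⟫⟪d,p⟫ − ⟪p,e₃⟫)` — no quadratic term: the scaling mode is blind to the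
linear part `τ·(e₃ × d)` of the rate column. [folklore] -/
theorem scalingMode_pairing_affine (p d : EuclideanSpace ℝ (Fin 3)) (hd : ‖d‖ = 1) (τ : ℝ) :
    ⟪d, EuclideanSpace.single 2 1⟫_ℝ * ‖p + τ • d‖ ^ 2 - ⟪d, p + τ • d⟫_ℝ * ⟪p + τ • d, EuclideanSpace.single 2 1⟫_ℝ
      = (⟪d, EuclideanSpace.single 2 1⟫_ℝ * ‖p‖ ^ 2 - ⟪d, p⟫_ℝ * ⟪p, EuclideanSpace.single 2 1⟫_ℝ)
        + τ * (⟪d, EuclideanSpace.single 2 1⟫_ℝ * ⟪d, p⟫_ℝ - ⟪p, EuclideanSpace.single 2 1⟫_ℝ) := by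
  have hdd : ⟪d, d⟫_ℝ = 1 := by rw [real_inner_self_eq_norm_sq, hd, one_pow]
  rw [@norm_add_sq_real, norm_smul, Real.norm_eq_abs, hd, mul_one, sq_abs, inner_add_right, inner_add_left,
    real_inner_smul_right, real_inner_smul_right, real_inner_smul_left, hdd, real_inner_comm p d]
  ring

/-- Hence the scaling-mode pairing density along the affine model is AFFINE in `τ` (unit `d`):
`⟪d × (½x − α e₃×x), e₃×x − ⟪e₃×x, d⟫d⟫ = ½(⟪d,e₃⟫‖p‖² − ⟪d,p⟫⟪p,e₃⟫) + (τ/2)(⟪d,e₃⟫⟪d,p⟫ − ⟪p,e₃⟫)`, `x = p + τ•d`. [folklore] -/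
theorem scalingMode_pairing_affine_density (p d : EuclideanSpace ℝ (Fin 3)) (hd : ‖d‖ = 1) (α τ : ℝ) :
    ⟪cross d ((1 / 2 : ℝ) • (p + τ • d) - α • cross (EuclideanSpace.single 2 1) (p + τ • d)),
        cross (EuclideanSpace.single 2 1) (p + τ • d) - ⟪cross (EuclideanSpace.single 2 1) (p + τ • d), d⟫_ℝ • d⟫_ℝ
      = (1 / 2 : ℝ) * (⟪d, EuclideanSpace.single 2 1⟫_ℝ * ‖p‖ ^ 2 - ⟪d, p⟫_ℝ * ⟪p, EuclideanSpace.single 2 1⟫_ℝ)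
        + τ / 2 * (⟪d, EuclideanSpace.single 2 1⟫_ℝ * ⟪d, p⟫_ℝ - ⟪p, EuclideanSpace.single 2 1⟫_ℝ) := by
  rw [scalingMode_pairing, scalingMode_pairing_affine p d hd τ]
  ring

/-- **On-axis straight filaments: the symmetry annihilator is blind.**  For a straight filament through the foot `p = 0` (waist ON the
similarity axis' foot) the scaling-mode pairing density vanishes identically along the filament. [folklore] -/
theorem scalingMode_pairing_onAxisLine (d : EuclideanSpace ℝ (Fin 3)) (hd : ‖d‖ = 1) (α τ : ℝ) :
    ⟪cross d ((1 / 2 : ℝ) • (τ • d) - α • cross (EuclideanSpace.single 2 1) (τ • d)),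
        cross (EuclideanSpace.single 2 1) (τ • d) - ⟪cross (EuclideanSpace.single 2 1) (τ • d), d⟫_ℝ • d⟫_ℝ = 0 := by
  have h := scalingMode_pairing_affine_density 0 d hd α τ
  simp only [zero_add, inner_zero_right, inner_zero_left, norm_zero, mul_zero, sub_zero] at h
  simpa using h

/-- **Size bookkeeping for the loss.**  If the waist offset is bounded, `‖p‖ ≤ P`, then the `τ`-independent part of the density is at most `P²`
in size: `|⟪d,e₃⟫‖p‖² − ⟪d,p⟫⟪p,e₃⟫| ≤ 2P²` (unit `d`; `‖e₃‖ = 1`).  Against the `L¹`-mass of the annihilator, which grows like the ball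
length squared, this is the `1/ℓ`-relative pairing behind the `√(log Γ)` loss described in the header. [folklore] -/
theorem scalingMode_constTerm_abs_le (p d : EuclideanSpace ℝ (Fin 3)) (hd : ‖d‖ = 1) {P : ℝ} (hp : ‖p‖ ≤ P) :
    |⟪d, EuclideanSpace.single 2 1⟫_ℝ * ‖p‖ ^ 2 - ⟪d, p⟫_ℝ * ⟪p, EuclideanSpace.single 2 1⟫_ℝ| ≤ 2 * P ^ 2 := by
  have he : ‖(EuclideanSpace.single 2 1 : EuclideanSpace ℝ (Fin 3))‖ = 1 := by rw [PiLp.norm_single, norm_one]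
  have hP : 0 ≤ P := le_trans (norm_nonneg _) hp
  have h1 : |⟪d, EuclideanSpace.single 2 1⟫_ℝ| ≤ 1 := by
    simpa [hd, he] using abs_real_inner_le_norm d (EuclideanSpace.single 2 1 : EuclideanSpace ℝ (Fin 3))
  have h2 : |⟪d, p⟫_ℝ| ≤ P := by
    have := abs_real_inner_le_norm d p; rw [hd, one_mul] at this; exact this.trans hp
  have h3 : |⟪p, EuclideanSpace.single 2 1⟫_ℝ| ≤ P := by
    have := abs_real_inner_le_norm p (EuclideanSpace.single 2 1 : EuclideanSpace ℝ (Fin 3))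
    rw [he, mul_one] at this; exact this.trans hp
  have hpp : ‖p‖ ^ 2 ≤ P ^ 2 := pow_le_pow_left₀ (norm_nonneg _) hp 2
  calc |⟪d, EuclideanSpace.single 2 1⟫_ℝ * ‖p‖ ^ 2 - ⟪d, p⟫_ℝ * ⟪p, EuclideanSpace.single 2 1⟫_ℝ|
      ≤ |⟪d, EuclideanSpace.single 2 1⟫_ℝ * ‖p‖ ^ 2| + |⟪d, p⟫_ℝ * ⟪p, EuclideanSpace.single 2 1⟫_ℝ| := abs_sub _ _
    _ = |⟪d, EuclideanSpace.single 2 1⟫_ℝ| * ‖p‖ ^ 2 + |⟪d, p⟫_ℝ| * |⟪p, EuclideanSpace.single 2 1⟫_ℝ| := by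
        rw [abs_mul, abs_mul, abs_of_nonneg (sq_nonneg ‖p‖)]
    _ ≤ 1 * P ^ 2 + P * P := by
        gcongr
    _ = 2 * P ^ 2 := by ring

/-! ## §3 (v2) The straight-filament MODEL conformal identity: weight `2μ + w′` (= `3/2` under the clause bookkeeping) -/

/-- **Model conformal identity, general coordinate form** (no hypothesis on `t` or on normality): for
`L y = A•(t × y″) + μ•y − β•(t × y) − w•y′`,
`⟪t × L y₁, y₂⟫ + ⟪t × y₁, L y₂⟫ = 2μ⟪t × y₁, y₂⟫ + A(⟪t,y₁″⟫⟪t,y₂⟫ − ⟪t,t⟫⟪y₁″,y₂⟫ + ⟪t,t⟫⟪y₁,y₂″⟫ − ⟪t,y₁⟫⟪t,y₂″⟫) − w(⟪t × y₁′, y₂⟫ + ⟪t × y₁, y₂′⟫)`;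
the `β`-terms cancel identically. [folklore] -/
theorem model_conformal_algebra (t y₁ y₁' y₁'' y₂ y₂' y₂'' : EuclideanSpace ℝ (Fin 3)) (A μ β w : ℝ) :
    ⟪cross t (A • cross t y₁'' + μ • y₁ - β • cross t y₁ - w • y₁'), y₂⟫_ℝ
      + ⟪cross t y₁, A • cross t y₂'' + μ • y₂ - β • cross t y₂ - w • y₂'⟫_ℝ
      = 2 * μ * ⟪cross t y₁, y₂⟫_ℝ
        + A * (⟪t, y₁''⟫_ℝ * ⟪t, y₂⟫_ℝ - ⟪t, t⟫_ℝ * ⟪y₁'', y₂⟫_ℝ + ⟪t, t⟫_ℝ * ⟪y₁, y₂''⟫_ℝ - ⟪t, y₁⟫_ℝ * ⟪t, y₂''⟫_ℝ)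
        - w * (⟪cross t y₁', y₂⟫_ℝ + ⟪cross t y₁, y₂'⟫_ℝ) := by
  simp only [cross, cross_apply, PiLp.inner_apply, RCLike.inner_apply, conj_trivial, Fin.sum_univ_three,
    Matrix.cons_val_zero, Matrix.cons_val_one, Matrix.cons_val_two, Matrix.head_cons, Matrix.tail_cons,
    WithLp.ofLp_sub, WithLp.ofLp_add, WithLp.ofLp_smul, Pi.sub_apply, Pi.add_apply, Pi.smul_apply, smul_eq_mul]
  ring

/-- **Model conformal identity at a normal station**: with `‖t‖ = 1` and `y₁, y₂ ⊥ t` the `A`-term is the exact flux derivative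
`A(⟪y₁, y₂″⟫ − ⟪y₁″, y₂⟫)`. [folklore] -/
theorem model_conformal_algebra_normal (t y₁ y₁' y₁'' y₂ y₂' y₂'' : EuclideanSpace ℝ (Fin 3)) (ht : ‖t‖ = 1)
    (h1 : ⟪y₁, t⟫_ℝ = 0) (h2 : ⟪y₂, t⟫_ℝ = 0) (A μ β w : ℝ) :
    ⟪cross t (A • cross t y₁'' + μ • y₁ - β • cross t y₁ - w • y₁'), y₂⟫_ℝ
      + ⟪cross t y₁, A • cross t y₂'' + μ • y₂ - β • cross t y₂ - w • y₂'⟫_ℝ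
      = 2 * μ * ⟪cross t y₁, y₂⟫_ℝ + A * (⟪y₁, y₂''⟫_ℝ - ⟪y₁'', y₂⟫_ℝ)
        - w * (⟪cross t y₁', y₂⟫_ℝ + ⟪cross t y₁, y₂'⟫_ℝ) := by
  have htt : ⟪t, t⟫_ℝ = 1 := by rw [real_inner_self_eq_norm_sq, ht, one_pow]
  have h1' : ⟪t, y₁⟫_ℝ = 0 := by rw [real_inner_comm]; exact h1
  have h2' : ⟪t, y₂⟫_ℝ = 0 := by rw [real_inner_comm]; exact h2
  rw [model_conformal_algebra, htt, h1', h2']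
  ring

/-- Leibniz rule for the flux `Φ = A(⟪Y₁, Y₂′⟫ − ⟪Y₁′, Y₂⟫) − w⟪t × Y₁, Y₂⟫`. [folklore] -/
theorem flux_hasDerivAt (t : EuclideanSpace ℝ (Fin 3)) {Y₁ Y₂ Y₁d Y₂d : ℝ → EuclideanSpace ℝ (Fin 3)} {w : ℝ → ℝ}
    {τ A : ℝ} {y₁'' y₂'' : EuclideanSpace ℝ (Fin 3)} {w' : ℝ}
    (hY₁ : HasDerivAt Y₁ (Y₁d τ) τ) (hY₂ : HasDerivAt Y₂ (Y₂d τ) τ)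
    (hY₁d : HasDerivAt Y₁d y₁'' τ) (hY₂d : HasDerivAt Y₂d y₂'' τ) (hw : HasDerivAt w w' τ) :
    HasDerivAt (fun σ => A * (⟪Y₁ σ, Y₂d σ⟫_ℝ - ⟪Y₁d σ, Y₂ σ⟫_ℝ) - w σ * ⟪cross t (Y₁ σ), Y₂ σ⟫_ℝ)
      (A * ((⟪Y₁d τ, Y₂d τ⟫_ℝ + ⟪Y₁ τ, y₂''⟫_ℝ) - (⟪y₁'', Y₂ τ⟫_ℝ + ⟪Y₁d τ, Y₂d τ⟫_ℝ))
        - (w' * ⟪cross t (Y₁ τ), Y₂ τ⟫_ℝ + w τ * (⟪cross t (Y₁d τ), Y₂ τ⟫_ℝ + ⟪cross t (Y₁ τ), Y₂d τ⟫_ℝ))) τ := by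
  have hJ : HasDerivAt (fun σ => cross t (Y₁ σ)) (cross t (Y₁d τ)) τ := by
    have h := ((crossCLM t).hasFDerivAt.comp_hasDerivAt τ hY₁)
    simpa [Function.comp_def, crossCLM_apply] using h
  have i1 := hY₁.inner ℝ hY₂d
  have i2 := hY₁d.inner ℝ hY₂
  have i3 := hJ.inner ℝ hY₂
  have h := ((i1.sub i2).const_mul A).sub (hw.mul i3)
  convert h using 1
  all_goals first | rfl | ring


/-- **The conformal identity as a total derivative (pointwise)**: at a station where `Y₁, Y₂ ⊥ t`,
`Φ′ = ⟪t × L₁, Y₂⟫ + ⟪t × Y₁, L₂⟫ − (2μ + w′)⟪t × Y₁, Y₂⟫`, `L_i = A•(t × Y_i″) + μ•Y_i − β•(t × Y_i) − w•Y_i′`. [folklore] -/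
theorem model_conformal_pointwise (t : EuclideanSpace ℝ (Fin 3)) (ht : ‖t‖ = 1)
    {Y₁ Y₂ Y₁d Y₂d : ℝ → EuclideanSpace ℝ (Fin 3)} {w : ℝ → ℝ} {τ A μ β w' : ℝ} {y₁'' y₂'' : EuclideanSpace ℝ (Fin 3)}
    (hY₁ : HasDerivAt Y₁ (Y₁d τ) τ) (hY₂ : HasDerivAt Y₂ (Y₂d τ) τ)
    (hY₁d : HasDerivAt Y₁d y₁'' τ) (hY₂d : HasDerivAt Y₂d y₂'' τ) (hw : HasDerivAt w w' τ)
    (h1 : ⟪Y₁ τ, t⟫_ℝ = 0) (h2 : ⟪Y₂ τ, t⟫_ℝ = 0) :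
    HasDerivAt (fun σ => A * (⟪Y₁ σ, Y₂d σ⟫_ℝ - ⟪Y₁d σ, Y₂ σ⟫_ℝ) - w σ * ⟪cross t (Y₁ σ), Y₂ σ⟫_ℝ)
      (⟪cross t (A • cross t y₁'' + μ • Y₁ τ - β • cross t (Y₁ τ) - w τ • Y₁d τ), Y₂ τ⟫_ℝ
        + ⟪cross t (Y₁ τ), A • cross t y₂'' + μ • Y₂ τ - β • cross t (Y₂ τ) - w τ • Y₂d τ⟫_ℝ
        - (2 * μ + w') * ⟪cross t (Y₁ τ), Y₂ τ⟫_ℝ) τ := by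
  refine (flux_hasDerivAt t (A := A) hY₁ hY₂ hY₁d hY₂d hw).congr_deriv ?_
  rw [model_conformal_algebra_normal t (Y₁ τ) (Y₁d τ) y₁'' (Y₂ τ) (Y₂d τ) y₂'' ht h1 h2 A μ β (w τ)]
  ring

/-- **Integrated model conformal identity against a CLAMPED field**: if `Y₂ = Y₂′ = 0` at `a` and `b`, then for EVERY normal `Y₁` (no boundary
condition) `∫_a^b ⟪t × L Y₁, Y₂⟫ + ⟪t × Y₁, L Y₂⟫ = ∫_a^b (2μ + w′)⟪t × Y₁, Y₂⟫` — conformal-symplectic with weight `2μ + w′`; by §1, exact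
annihilators of `range L|_clamped` are `t × K` with `(L − (2μ + w′))K = 0` when the weight is constant (`= 3/2` in the clause bookkeeping of the
header). [folklore] -/
theorem model_conformal_integral (t : EuclideanSpace ℝ (Fin 3)) (ht : ‖t‖ = 1)
    {Y₁ Y₂ Y₁d Y₂d Y₁dd Y₂dd : ℝ → EuclideanSpace ℝ (Fin 3)} {w wd : ℝ → ℝ} {A μ β a b : ℝ}
    (hY₁ : ∀ σ, HasDerivAt Y₁ (Y₁d σ) σ) (hY₂ : ∀ σ, HasDerivAt Y₂ (Y₂d σ) σ)
    (hY₁d : ∀ σ, HasDerivAt Y₁d (Y₁dd σ) σ) (hY₂d : ∀ σ, HasDerivAt Y₂d (Y₂dd σ) σ) (hw : ∀ σ, HasDerivAt w (wd σ) σ)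
    (hY₁dd : Continuous Y₁dd) (hY₂dd : Continuous Y₂dd) (hwd : Continuous wd)
    (h1 : ∀ σ, ⟪Y₁ σ, t⟫_ℝ = 0) (h2 : ∀ σ, ⟪Y₂ σ, t⟫_ℝ = 0)
    (ha : Y₂ a = 0) (ha' : Y₂d a = 0) (hb : Y₂ b = 0) (hb' : Y₂d b = 0) :
    ∫ σ in a..b, (⟪cross t (A • cross t (Y₁dd σ) + μ • Y₁ σ - β • cross t (Y₁ σ) - w σ • Y₁d σ), Y₂ σ⟫_ℝ
        + ⟪cross t (Y₁ σ), A • cross t (Y₂dd σ) + μ • Y₂ σ - β • cross t (Y₂ σ) - w σ • Y₂d σ⟫_ℝ)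
      = ∫ σ in a..b, (2 * μ + wd σ) * ⟪cross t (Y₁ σ), Y₂ σ⟫_ℝ := by
  have cY₁ : Continuous Y₁ := continuous_iff_continuousAt.2 fun σ => (hY₁ σ).continuousAt
  have cY₂ : Continuous Y₂ := continuous_iff_continuousAt.2 fun σ => (hY₂ σ).continuousAt
  have cY₁d : Continuous Y₁d := continuous_iff_continuousAt.2 fun σ => (hY₁d σ).continuousAt
  have cY₂d : Continuous Y₂d := continuous_iff_continuousAt.2 fun σ => (hY₂d σ).continuousAt
  have cw : Continuous w := continuous_iff_continuousAt.2 fun σ => (hw σ).continuousAt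
  have ccross : ∀ {F : ℝ → EuclideanSpace ℝ (Fin 3)}, Continuous F → Continuous fun σ => cross t (F σ) :=
    fun hF => (crossCLM t).continuous.comp hF
  set G : ℝ → ℝ := fun σ => ⟪cross t (A • cross t (Y₁dd σ) + μ • Y₁ σ - β • cross t (Y₁ σ) - w σ • Y₁d σ), Y₂ σ⟫_ℝ
        + ⟪cross t (Y₁ σ), A • cross t (Y₂dd σ) + μ • Y₂ σ - β • cross t (Y₂ σ) - w σ • Y₂d σ⟫_ℝ
        - (2 * μ + wd σ) * ⟪cross t (Y₁ σ), Y₂ σ⟫_ℝ with hG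
  have cG : Continuous G := by
    rw [hG]
    have c1 : Continuous fun σ => A • cross t (Y₁dd σ) + μ • Y₁ σ - β • cross t (Y₁ σ) - w σ • Y₁d σ :=
      (((ccross hY₁dd).const_smul A).add (cY₁.const_smul μ)).sub ((ccross cY₁).const_smul β) |>.sub (cw.smul cY₁d)
    have c2 : Continuous fun σ => A • cross t (Y₂dd σ) + μ • Y₂ σ - β • cross t (Y₂ σ) - w σ • Y₂d σ :=
      (((ccross hY₂dd).const_smul A).add (cY₂.const_smul μ)).sub ((ccross cY₂).const_smul β) |>.sub (cw.smul cY₂d)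
    exact (((ccross c1).inner cY₂).add ((ccross cY₁).inner c2)).sub
      ((continuous_const.add hwd).mul ((ccross cY₁).inner cY₂))
  have hderiv : ∀ σ ∈ Set.uIcc a b,
      HasDerivAt (fun σ => A * (⟪Y₁ σ, Y₂d σ⟫_ℝ - ⟪Y₁d σ, Y₂ σ⟫_ℝ) - w σ * ⟪cross t (Y₁ σ), Y₂ σ⟫_ℝ) (G σ) σ := by
    intro σ _
    rw [hG]
    exact model_conformal_pointwise t ht (hY₁ σ) (hY₂ σ) (hY₁d σ) (hY₂d σ) (hw σ) (h1 σ) (h2 σ)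
  have hFTC := intervalIntegral.integral_eq_sub_of_hasDerivAt hderiv (cG.intervalIntegrable a b)
  have hzero : ∫ σ in a..b, G σ = 0 := by
    rw [hFTC, ha, ha', hb, hb']
    simp
  have i1 : IntervalIntegrable (fun σ => ⟪cross t (A • cross t (Y₁dd σ) + μ • Y₁ σ - β • cross t (Y₁ σ) - w σ • Y₁d σ), Y₂ σ⟫_ℝ
        + ⟪cross t (Y₁ σ), A • cross t (Y₂dd σ) + μ • Y₂ σ - β • cross t (Y₂ σ) - w σ • Y₂d σ⟫_ℝ) MeasureTheory.volume a b := by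
    have : Continuous fun σ => G σ + (2 * μ + wd σ) * ⟪cross t (Y₁ σ), Y₂ σ⟫_ℝ :=
      cG.add ((continuous_const.add hwd).mul ((ccross cY₁).inner cY₂))
    refine (this.intervalIntegrable a b).congr ?_
    intro σ _
    simp only [hG]
    ring
  have i2 : IntervalIntegrable (fun σ => (2 * μ + wd σ) * ⟪cross t (Y₁ σ), Y₂ σ⟫_ℝ) MeasureTheory.volume a b :=
    ((continuous_const.add hwd).mul ((ccross cY₁).inner cY₂)).intervalIntegrable a b
  have hsplit : ∫ σ in a..b, G σ = (∫ σ in a..b, (⟪cross t (A • cross t (Y₁dd σ) + μ • Y₁ σ - β • cross t (Y₁ σ) - w σ • Y₁d σ), Y₂ σ⟫_ℝ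
        + ⟪cross t (Y₁ σ), A • cross t (Y₂dd σ) + μ • Y₂ σ - β • cross t (Y₂ σ) - w σ • Y₂d σ⟫_ℝ))
        - ∫ σ in a..b, (2 * μ + wd σ) * ⟪cross t (Y₁ σ), Y₂ σ⟫_ℝ := by
    rw [← intervalIntegral.integral_sub i1 i2]
  rw [hsplit] at hzero
  linarith


/-! ## §4 (v3) Model: eigen-solutions of the constant weight `2μ + κ` are exact annihilators of the clamped range -/


/-- **Model annihilator from an eigen-solution (v3).**  In the straight-filament model with LINEAR slip (`w′ ≡ κ`, so the conformal weight
`c = 2μ + κ` is constant), every normal field `K` (NO boundary condition) solving the eigen-equation `L K = c•K` on the line gives an exact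
annihilator `t × K` of the clamped range: `∫_a^b ⟪t × K, L Y⟫ = 0` for every normal `Y` with `Y = Y′ = 0` at `a, b`.  This is §1's
`annihilates_of_conformal_eigen` realised through §3's integrated identity — the model form of «exact annihilators = J·ker(DT − 3/2)|_ball». [folklore] -/
theorem model_annihilator_of_eigen (t : EuclideanSpace ℝ (Fin 3)) (ht : ‖t‖ = 1)
    {K Y Kd Yd Kdd Ydd : ℝ → EuclideanSpace ℝ (Fin 3)} {w wd : ℝ → ℝ} {A μ β κ a b : ℝ}
    (hK : ∀ σ, HasDerivAt K (Kd σ) σ) (hY : ∀ σ, HasDerivAt Y (Yd σ) σ)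
    (hKd : ∀ σ, HasDerivAt Kd (Kdd σ) σ) (hYd : ∀ σ, HasDerivAt Yd (Ydd σ) σ) (hw : ∀ σ, HasDerivAt w (wd σ) σ)
    (hwd : ∀ σ, wd σ = κ) (hKdd : Continuous Kdd) (hYdd : Continuous Ydd)
    (h1 : ∀ σ, ⟪K σ, t⟫_ℝ = 0) (h2 : ∀ σ, ⟪Y σ, t⟫_ℝ = 0)
    (ha : Y a = 0) (ha' : Yd a = 0) (hb : Y b = 0) (hb' : Yd b = 0)
    (heig : ∀ σ, A • cross t (Kdd σ) + μ • K σ - β • cross t (K σ) - w σ • Kd σ = (2 * μ + κ) • K σ) :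
    ∫ σ in a..b, ⟪cross t (K σ), A • cross t (Ydd σ) + μ • Y σ - β • cross t (Y σ) - w σ • Yd σ⟫_ℝ = 0 := by
  have hwdc : Continuous wd := by
    have : wd = fun _ => κ := funext hwd
    rw [this]; exact continuous_const
  have hI := model_conformal_integral t ht (A := A) (μ := μ) (β := β) hK hY hKd hYd hw hKdd hYdd hwdc h1 h2 ha ha' hb hb'
  have cK : Continuous K := continuous_iff_continuousAt.2 fun σ => (hK σ).continuousAt
  have cY : Continuous Y := continuous_iff_continuousAt.2 fun σ => (hY σ).continuousAt
  have cYd : Continuous Yd := continuous_iff_continuousAt.2 fun σ => (hYd σ).continuousAt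
  have cw : Continuous w := continuous_iff_continuousAt.2 fun σ => (hw σ).continuousAt
  have ccross : ∀ {F : ℝ → EuclideanSpace ℝ (Fin 3)}, Continuous F → Continuous fun σ => cross t (F σ) :=
    fun hF => (crossCLM t).continuous.comp hF
  have cLY : Continuous fun σ => A • cross t (Ydd σ) + μ • Y σ - β • cross t (Y σ) - w σ • Yd σ :=
    (((ccross hYdd).const_smul A).add (cY.const_smul μ)).sub ((ccross cY).const_smul β) |>.sub (cw.smul cYd)
  have cg : Continuous fun σ => ⟪cross t (K σ), A • cross t (Ydd σ) + μ • Y σ - β • cross t (Y σ) - w σ • Yd σ⟫_ℝ :=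
    (ccross cK).inner cLY
  have ch : Continuous fun σ => (2 * μ + wd σ) * ⟪cross t (K σ), Y σ⟫_ℝ :=
    (continuous_const.add hwdc).mul ((ccross cK).inner cY)
  -- substitute the eigen-equation in the first pairing
  have hfirst : ∀ σ, ⟪cross t (A • cross t (Kdd σ) + μ • K σ - β • cross t (K σ) - w σ • Kd σ), Y σ⟫_ℝ
      = (2 * μ + wd σ) * ⟪cross t (K σ), Y σ⟫_ℝ := by
    intro σ
    rw [heig σ, hwd σ, ← crossCLM_apply, map_smul, crossCLM_apply, real_inner_smul_left]
  have hI' : ∫ σ in a..b, ((2 * μ + wd σ) * ⟪cross t (K σ), Y σ⟫_ℝ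
      + ⟪cross t (K σ), A • cross t (Ydd σ) + μ • Y σ - β • cross t (Y σ) - w σ • Yd σ⟫_ℝ)
      = ∫ σ in a..b, (2 * μ + wd σ) * ⟪cross t (K σ), Y σ⟫_ℝ := by
    rw [← hI]
    refine intervalIntegral.integral_congr fun σ _ => ?_
    simp only [hfirst σ]
  rw [intervalIntegral.integral_add (ch.intervalIntegrable a b) (cg.intervalIntegrable a b)] at hI'
  linarith


end Summit.NavierStokesRegularity.NavierStokesRegularity.Theorems.Clause13RScalingAnnihilator

end
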